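import Summits.ValiantsHypothesis.ValiantsHypothesis.Theorems.FifoMatchingNNDivisionHardLocatedRowsColumnCoupled
import HarnessLib

/-!
# LOCATED ROWS — part 6/8 — §4c′ `Q∘` is a column-coupled affine cube; §4d ★ the DIAGONAL PERMUTAHEDRON `Q^Π_λ = conv{−λ·diag π}` is PIN-EXPOSED, hence decided by the exact-rhs located laws (crit-9's open question of wave 6, exact half; N22: the box-rhs `LocatedPencilLaw` is FALSE there, ✓ `…Negative.LocatedPencilLawFalse*`)

Theorems-side port (staged by val-idea-40 g5 for the desk's P-W6b hand; declaration texts VERBATIM, namespace `…Theorems.FifoMatching.LocatedRows`) of val-idea-40 g5's crux workfile `Cruxes/NNDivisionHard/LocatedRows.lean` REV 5 @4b120a7727c3 (sha16 18e097fc3d9fe11e, 1953 l.; critic of record val-idea-crit-9 g2 VERDICTS #48 / #54 / #58: VERIFIED KEEP, axioms standard), split by the 400-line cap into seven chained modules `…RowFamilies` (§1, §2, §4e-frame) → `…LocatedRowsZeroDiag` (§3) → `…LocatedRowsPairPencil` (§4) → `…LocatedRowsPinExposed` (§4b) → `…LocatedRowsColumnCoupled` (§4c) → `…LocatedRowsPermutahedron`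 (§4c′, §4d) → `…LocatedRowsCeiling` (§5, §5b).

* `qOffBase`, `qOffGen`, `qOff_eq_cubePt`, `columnCoupled_qOff`; `qPerm`, `pD`, `pM`, `pinW`, `pin_value`, `sum_rev_le`, ★★ `pinExposed_qPerm`, `qPerm_decided`, `pinnedRows_law_holds_on_qPerm`; `exactTilted_law_holds_on_qPerm` (workfile §4e).

HONEST LABEL: helper rows for an OPEN crux (21181 `NNDivisionHard` OPEN; `ExactPencilLaw`, `allRows.Law`, COR-VIRTUAL OPEN); the `Law`s are `Prop`-valued definitions, nothing open is asserted; VP ≠ VNP is NOT proved.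
-/

set_option autoImplicit false

-- the mandated summit-side namespace repeats a component by design (single-problem summit)
set_option linter.dupNamespace false

noncomputable section

open Matrix Finset
open scoped Pointwise

namespace Summit.ValiantsHypothesis.ValiantsHypothesis.Theorems.FifoMatching.LocatedRows

open Literature.Barriers.PneNP (HasEFOfSize three_pow_le_card_mul_two_pow_of_cover_univ)
open Literature.Combinatorics.Optimization.FixedSizePsdRank (Cube bvec flat vecOuter corPolytope flat_dotProduct_vecOuter
  flat_dotProduct_le_of_mem_corPolytope)
open Summit.ValiantsHypothesis.ValiantsHypothesis.Theorems.FifoMatching.XcDivision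
  (udInd udPt udRow udMat udInd_apply udInd_sq udInd_inter ud_data udRow_dotProduct_flat_diagonal flat_dotProduct_flat
    dot_le_of_mem_convexHull)
open Summit.ValiantsHypothesis.Theorems.NNDivisionHardNegative.CliqueRowBlind (sum_udInd_mem sum_udInd_univ)
open Summit.ValiantsHypothesis.ValiantsHypothesis.Theorems.FifoMatching.GridCorShadow (four_T_lt_two_pow)
open Summit.ValiantsHypothesis.Theorems.NNDivisionHardNegative.DiagTilted
  (qOff qOffMat qOff_eq hasEFOfSize_qOff udRow_dotProduct_qOff udInd_compl udInd_univ)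

section ColumnClassQOff
variable {n N : ℕ}

/-! ### `Q^∘` is a column-coupled affine cube -/

/-- base point of `Q^∘`: `n²(J − I)`. -/
def qOffBase (n : ℕ) : Matrix (Fin n) (Fin n) ℝ := fun i m => if i = m then 0 else (n : ℝ) ^ 2

/-- generators of `Q^∘`: `(g_l)_{im} = n − n²([l = i] + [l = m])` off the diagonal, `0` on it. -/
def qOffGen (n : ℕ) (l : Fin n) : Matrix (Fin n) (Fin n) ℝ := fun i m =>
  if i = m then 0 else (n : ℝ) - (n : ℝ) ^ 2 * ((if i = l then 1 else 0) + (if m = l then 1 else 0))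

/-- `Q^∘` IS the affine cube `n²(J−I) + Σ_{l∈P} g_l`. -/
theorem qOff_eq_cubePt (P : Finset (Fin n)) : qOff P = cubePt (qOffBase n) (qOffGen n) P := by
  classical
  funext p
  simp only [qOff, qOffMat, cubePt, flat, qOffBase, qOffGen, Matrix.add_apply, Matrix.sum_apply]
  set i := (finProdFinEquiv.symm p).1
  set m := (finProdFinEquiv.symm p).2
  by_cases h : i = m
  · simp [h]
  · simp only [if_neg h]
    have h1 : ∑ g ∈ P, ((n : ℝ) - (n : ℝ) ^ 2 * ((if i = g then (1 : ℝ) else 0) + (if m = g then (1 : ℝ) else 0)))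
        = (n : ℝ) * P.card - (n : ℝ) ^ 2 * (udInd P i + udInd P m) := by
      rw [Finset.sum_sub_distrib, Finset.sum_const, nsmul_eq_mul, ← Finset.mul_sum, Finset.sum_add_distrib,
        Finset.sum_ite_eq, Finset.sum_ite_eq, ← udInd_apply, ← udInd_apply]
      ring
    rw [h1]
    ring

/-- `Q^∘` is column-coupled (`n ≥ 2`): the entry `(x′, x)` is moved by every generator, by `n` or `n − n²`. -/
theorem columnCoupled_qOff (hn : 2 ≤ n) {x x' : Fin n} (hx : x' ≠ x) : ColumnCoupled (qOffGen n) := by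
  refine columnCoupled_of_entry x x' fun g => ?_
  have hn' : (2 : ℝ) ≤ n := by exact_mod_cast hn
  simp only [qOffGen, if_neg hx]
  by_cases h1 : x' = g
  · have h2 : ¬ x = g := fun h2 => hx (h1.trans h2.symm)
    rw [if_pos h1, if_neg h2, add_zero, mul_one, le_abs]
    right; nlinarith
  · by_cases h2 : x = g
    · rw [if_neg h1, if_pos h2, zero_add, mul_one, le_abs]
      right; nlinarith
    · rw [if_neg h1, if_neg h2, add_zero, mul_zero, sub_zero, le_abs]
      left; linarith

end ColumnClassQOff

/-! ## §4d ★ THE OPEN QUESTION OF WAVE 6 (crit-9 g2, 22:52:44Z) — EXACT-rhs half: the DIAGONAL PERMUTAHEDRON is PIN-EXPOSED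

`Q^Π_λ = conv{−λ·diag π : π ∈ S_n}` (xc `O(n log n)`, Goemans).  crit-9's reduction «C⁺_entry-blind ⟺ C⁺_diag-blind» for a
diagonal passenger is a BOX-currency statement (off-diagonal tilt entries only add `cone{1 − b_ib_k, b_ib_k}` junk).  In EXACT-rhs
located currency (`pinnedRows`, class `PinExposed`) the passenger is DECIDED, in kernel: pin `S = {s₀}`, `s₀ = n − 1`, direction
`w = flat(diag D) + flat(colTilt s₀ M)`, `D = (1, 2, …, n−1 ↦ …, n²  at s₀)`, `M = (i+1)_{i≠s₀}, 0 at s₀` — so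
`⟨w, bbᵀ⟩ = Σ_{i∈b} D_i − b_{s₀}·Σ_{i∈b} M_i` equals `n²` on the WHOLE face `{b ∋ s₀}` (`pinW_dotProduct_udPt_of_mem`) and is `≤ n²`
off it; `⟨udRow a + w, q_π⟩ = −λ·Σ_i (D_i + [i ∈ a])·π(i)` (`pin_value`; the column part pairs to `0` with a diagonal passenger), and
`i ↦ D_i + [i ∈ a]` is MONOTONE for EVERY `a` — the order-reversing permutation `rev` is a COMMON maximiser of all tilted rows
(rearrangement inequality, `sum_rev_le`).  Hence `pinExposed_qPerm`, ★★★ `qPerm_decided` (xc currency, flat socket: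
`HasEFOfSize (COR(n) + conv q) r → T c n < r` for every listing `q` of `Q^Π_λ` containing `rev`, `λ ≥ 0`, eventually in `n`) and
`pinnedRows_law_holds_on_qPerm` (Law currency).  BOX currency (paper, for W6-R1): the same `w` has box junk
`‖w⁺‖₁ − ⟨w, bbᵀ⟩ = Σ_{i<s₀}(i+1) =: C` on the window, and `(1−|a∩b|)² + C = Σ_{i≠k∈a} b_ib_k + Σ_{i∈a}(1−b_i) + (C+1−|a|)` factorises
with `n² + n + 1` slots as soon as `C ≥ n − 1`: a-INDEPENDENT located directions decide nothing about `Q^Π` in box currency, and the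
residual box question is exactly crit-9's `rank₊ M_{a,σ}` with a-DEPENDENT diagonal `σ`.  So «is `Q^Π` blind to located pencils?»
SPLITS BY CURRENCY: NO for exact right-hand sides (this section), OPEN for box right-hand sides (`LocatedPencilLaw` as typed). -/

section PermClass
variable {n : ℕ}

/-- the DIAGONAL PERMUTAHEDRON passenger `Q^Π_λ`: `q_π = flat (diag (−λ·π(i))_i)`. -/
def qPerm (n : ℕ) (lam : ℝ) (π : Equiv.Perm (Fin n)) : Fin (n * n) → ℝ :=
  flat (Matrix.diagonal fun i => -(lam * (((π i : Fin n) : ℕ) : ℝ)))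

/-- diagonal profile of the pin direction: `i + 1`, and `n²` at the pin `s₀`. -/
def pD (n : ℕ) (s₀ : Fin n) : Fin n → ℝ := fun i => if i = s₀ then (n : ℝ) ^ 2 else ((i : ℕ) : ℝ) + 1

/-- column-`s₀` coupling of the pin direction: `i + 1` off the pin, `0` at the pin. -/
def pM (n : ℕ) (s₀ : Fin n) : Fin n → ℝ := fun i => if i = s₀ then 0 else ((i : ℕ) : ℝ) + 1

/-- the PIN DIRECTION `w = diag D − Σ_{i≠s₀} (i+1) E_{i s₀}` (flat). -/
def pinW (n : ℕ) (s₀ : Fin n) : Fin (n * n) → ℝ :=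
  flat (Matrix.diagonal (pD n s₀)) + flat (colTilt s₀ (pM n s₀))

/-- `⟨flat (diag D), x_b⟩ = Σ_{i∈b} D_i`. -/
theorem flat_diagonal_dotProduct_udPt (D : Fin n → ℝ) (b : Finset (Fin n)) :
    flat (Matrix.diagonal D) ⬝ᵥ udPt b = ∑ i ∈ b, D i := by
  classical
  rw [show udPt b = vecOuter n (udInd b) from rfl, flat_dotProduct_vecOuter]
  have h : ∀ i, ∑ j, Matrix.diagonal D i j * (udInd b i * udInd b j) = if i ∈ b then D i else 0 := fun i => by
    rw [Finset.sum_eq_single i (fun j _ hj => by rw [Matrix.diagonal_apply_ne _ (Ne.symm hj)]; ring)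
      (fun h => absurd (Finset.mem_univ _) h), Matrix.diagonal_apply_eq, udInd_apply]
    split_ifs <;> ring
  simp_rw [h]
  rw [Finset.sum_ite_mem, Finset.univ_inter]

/-- `⟨flat (colTilt x₀ M), x_b⟩ = −𝟙_b(x₀)·Σ_{p∈b} M_p`. -/
theorem colTilt_dotProduct_udPt' (x₀ : Fin n) (M : Fin n → ℝ) (b : Finset (Fin n)) :
    flat (colTilt x₀ M) ⬝ᵥ udPt b = -(udInd b x₀ * ∑ i ∈ b, M i) := by
  classical
  rw [show udPt b = vecOuter n (udInd b) from rfl, flat_dotProduct_vecOuter]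
  have h : ∀ i, ∑ j, colTilt x₀ M i j * (udInd b i * udInd b j) = -(udInd b x₀ * if i ∈ b then M i else 0) := fun i => by
    rw [Finset.sum_eq_single x₀ (fun j _ hj => by simp [colTilt, hj]) (fun h => absurd (Finset.mem_univ _) h)]
    simp only [colTilt, if_true]
    rw [udInd_apply b i]
    split_ifs <;> ring
  simp_rw [h]
  rw [Finset.sum_neg_distrib, ← Finset.mul_sum, Finset.sum_ite_mem, Finset.univ_inter]

/-- `⟨flat (diag D), flat (diag v)⟩ = Σ_i D_i v_i`. -/
theorem flat_diagonal_dotProduct_flat_diagonal (D v : Fin n → ℝ) :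
    flat (Matrix.diagonal D) ⬝ᵥ flat (Matrix.diagonal v) = ∑ i, D i * v i := by
  rw [flat_dotProduct_flat]
  refine Finset.sum_congr rfl fun i _ => ?_
  rw [Finset.sum_eq_single i (fun j _ hj => by rw [Matrix.diagonal_apply_ne _ (Ne.symm hj)]; ring)
    (fun h => absurd (Finset.mem_univ _) h), Matrix.diagonal_apply_eq, Matrix.diagonal_apply_eq]

/-- the pin direction's value at a clique vertex. -/
theorem pinW_dotProduct_udPt (s₀ : Fin n) (b : Finset (Fin n)) :
    pinW n s₀ ⬝ᵥ udPt b = ∑ i ∈ b, pD n s₀ i - udInd b s₀ * ∑ i ∈ b, pM n s₀ i := by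
  rw [pinW, add_dotProduct, flat_diagonal_dotProduct_udPt, colTilt_dotProduct_udPt']
  ring

/-- the pin direction is MAXIMAL (`= n²`) on the whole coordinate face `{b ∋ s₀}` … -/
theorem pinW_dotProduct_udPt_of_mem (s₀ : Fin n) {b : Finset (Fin n)} (h : s₀ ∈ b) :
    pinW n s₀ ⬝ᵥ udPt b = (n : ℝ) ^ 2 := by
  rw [pinW_dotProduct_udPt, udInd_apply, if_pos h, one_mul, ← Finset.sum_sub_distrib]
  have hd : ∀ i, pD n s₀ i - pM n s₀ i = if i = s₀ then (n : ℝ) ^ 2 else 0 := fun i => by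
    unfold pD pM; split_ifs <;> ring
  simp_rw [hd]
  rw [Finset.sum_ite_eq', if_pos h]

/-- … and at most `n²` off it. -/
theorem pinW_dotProduct_udPt_le (s₀ : Fin n) {b : Finset (Fin n)} (h : s₀ ∉ b) :
    pinW n s₀ ⬝ᵥ udPt b ≤ (n : ℝ) ^ 2 := by
  rw [pinW_dotProduct_udPt, udInd_apply, if_neg h, zero_mul, sub_zero]
  have hle : ∀ i ∈ b, pD n s₀ i ≤ (n : ℝ) := fun i hi => by
    have his : i ≠ s₀ := fun h' => h (h' ▸ hi)
    simp only [pD, if_neg his]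
    have := i.2
    exact_mod_cast this
  calc ∑ i ∈ b, pD n s₀ i ≤ ∑ _i ∈ b, (n : ℝ) := Finset.sum_le_sum hle
    _ = b.card * (n : ℝ) := by rw [Finset.sum_const, nsmul_eq_mul]
    _ ≤ (n : ℝ) * n := by
        have : (b.card : ℝ) ≤ n := by exact_mod_cast (Finset.card_le_univ b).trans_eq (Fintype.card_fin n)
        exact mul_le_mul_of_nonneg_right this (Nat.cast_nonneg n)
    _ = (n : ℝ) ^ 2 := by ring

/-- the pin direction is valid on `COR(n)` with rhs its value at `x_{{s₀}}`. -/
theorem pinW_valid (s₀ : Fin n) : ∀ x ∈ corPolytope n, pinW n s₀ ⬝ᵥ x ≤ (n : ℝ) ^ 2 := by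
  classical
  refine dot_le_of_mem_convexHull _ _ _ ?_
  rintro _ ⟨c, rfl⟩
  show pinW n s₀ ⬝ᵥ vecOuter n (bvec c) ≤ _
  have hc : vecOuter n (bvec c) = udPt (Finset.univ.filter fun j => c j = true) := by
    show vecOuter n (bvec c) = vecOuter n (udInd _)
    congr 1
    funext j
    rw [udInd_apply]
    simp only [Finset.mem_filter, Finset.mem_univ, true_and, bvec]
  rw [hc]
  by_cases hs : s₀ ∈ Finset.univ.filter fun j => c j = true
  · rw [pinW_dotProduct_udPt_of_mem s₀ hs]
  · exact pinW_dotProduct_udPt_le s₀ hs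

/-- the tilted pinned row on the permutahedron: `⟨udRow a + w, q_π⟩ = −λ Σ_i (D_i + [i ∈ a]) π(i)` (column part pairs to `0`). -/
theorem pin_value (s₀ : Fin n) (a : Finset (Fin n)) (lam : ℝ) (π : Equiv.Perm (Fin n)) :
    (udRow a + pinW n s₀) ⬝ᵥ qPerm n lam π = -(lam * ∑ i, (pD n s₀ i + udInd a i) * (((π i : Fin n) : ℕ) : ℝ)) := by
  classical
  rw [qPerm, pinW, add_dotProduct, add_dotProduct, udRow_dotProduct_flat_diagonal, flat_diagonal_dotProduct_flat_diagonal,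
    colTilt_dotProduct_flat]
  have h0 : ∑ l, pM n s₀ l * Matrix.diagonal (fun i => -(lam * (((π i : Fin n) : ℕ) : ℝ))) l s₀ = 0 := by
    rw [Finset.sum_eq_single s₀ (fun l _ hl => by rw [Matrix.diagonal_apply_ne _ hl, mul_zero])
      (fun h => absurd (Finset.mem_univ _) h)]
    simp [pM]
  have ha : ∑ i ∈ a, -(lam * (((π i : Fin n) : ℕ) : ℝ)) = ∑ i, udInd a i * -(lam * (((π i : Fin n) : ℕ) : ℝ)) := by
    simp_rw [udInd_apply, ite_mul, one_mul, zero_mul]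
    rw [Finset.sum_ite_mem, Finset.univ_inter]
  rw [h0, neg_zero, add_zero, ha, ← Finset.sum_add_distrib, Finset.mul_sum, ← Finset.sum_neg_distrib]
  exact Finset.sum_congr rfl fun i _ => by ring

/-- REARRANGEMENT: with the pin at the top index, `i ↦ D_i + [i ∈ a]` is monotone for every `a`, so `rev` minimises
`Σ_i (D_i + [i ∈ a]) π(i)` over all permutations `π`. -/
theorem sum_rev_le (hn : 2 ≤ n) (s₀ : Fin n) (hs : (s₀ : ℕ) = n - 1) (a : Finset (Fin n)) (π : Equiv.Perm (Fin n)) :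
    ∑ i, (pD n s₀ i + udInd a i) * (((Fin.revPerm i : Fin n) : ℕ) : ℝ)
      ≤ ∑ i, (pD n s₀ i + udInd a i) * (((π i : Fin n) : ℕ) : ℝ) := by
  classical
  set f : Fin n → ℝ := fun i => pD n s₀ i + udInd a i with hf
  set g : Fin n → ℝ := fun i => (((Fin.revPerm i : Fin n) : ℕ) : ℝ) with hg
  have hu0 : ∀ i, 0 ≤ udInd a i := fun i => by rw [udInd_apply]; split_ifs <;> norm_num
  have hu1 : ∀ i, udInd a i ≤ 1 := fun i => by rw [udInd_apply]; split_ifs <;> norm_num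
  have hfg : Antivary f g := by
    intro i j hij
    -- `g i < g j` means `rev i < rev j`, i.e. `j < i`
    have hji : j < i := by
      have h1 : ((Fin.rev i : Fin n) : ℕ) < ((Fin.rev j : Fin n) : ℕ) := by
        have := hij; simp only [hg, Fin.revPerm_apply] at this; exact_mod_cast this
      exact Fin.rev_lt_rev.1 (Fin.lt_def.2 h1)
    have hjv : (j : ℕ) < i := hji
    have hjs : j ≠ s₀ := fun h => by rw [h, hs] at hjv; have := i.2; omega
    show pD n s₀ j + udInd a j ≤ pD n s₀ i + udInd a i
    have hpj : pD n s₀ j = ((j : ℕ) : ℝ) + 1 := by simp [pD, hjs]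
    have hpi : ((j : ℕ) : ℝ) + 2 ≤ pD n s₀ i := by
      by_cases his : i = s₀
      · simp only [pD, if_pos his]
        have h2 : (j : ℕ) + 2 ≤ n := by have := i.2; omega
        have h3 : (n : ℝ) ≤ (n : ℝ) ^ 2 := by
          have : (1 : ℝ) ≤ n := by exact_mod_cast (by omega : 1 ≤ n)
          nlinarith
        calc ((j : ℕ) : ℝ) + 2 = (((j : ℕ) + 2 : ℕ) : ℝ) := by push_cast; ring
          _ ≤ n := by exact_mod_cast h2
          _ ≤ (n : ℝ) ^ 2 := h3
      · simp only [pD, if_neg his]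
        have : (j : ℕ) + 1 ≤ i := hjv
        calc ((j : ℕ) : ℝ) + 2 = (((j : ℕ) + 1 : ℕ) : ℝ) + 1 := by push_cast; ring
          _ ≤ ((i : ℕ) : ℝ) + 1 := by gcongr
    rw [hpj]
    linarith [hu1 j, hu0 i]
  have key := Antivary.sum_mul_le_sum_mul_comp_perm (σ := π.trans Fin.revPerm.symm) hfg
  have hgσ : ∀ i, g ((π.trans Fin.revPerm.symm) i) = (((π i : Fin n) : ℕ) : ℝ) := fun i => by
    simp only [hg, Equiv.trans_apply, Equiv.apply_symm_apply]
  simp_rw [hgσ] at key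
  exact key

/-- ★★ `Q^Π_λ` IS PIN-EXPOSED: pin `{s₀}` at the top index, direction `pinW`, common maximiser `rev`. -/
theorem pinExposed_qPerm (hn : 2 ≤ n) (s₀ : Fin n) (hs : (s₀ : ℕ) = n - 1) {lam : ℝ} (hlam : 0 ≤ lam) {K : ℕ}
    (e : Fin (K + 1) → Equiv.Perm (Fin n)) (jstar : Fin (K + 1)) (hj : e jstar = Fin.revPerm) :
    PinExposed n K (qPerm n lam ∘ e) := by
  classical
  refine ⟨{s₀}, pinW n s₀, jstar, ?_, ?_, ?_, ?_⟩
  · rw [Finset.card_singleton]; omega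
  · intro x hx
    rw [pinW_dotProduct_udPt_of_mem s₀ (Finset.mem_singleton_self s₀)]
    exact pinW_valid s₀ x hx
  · intro b hb
    rw [pinW_dotProduct_udPt_of_mem s₀ (hb (Finset.mem_singleton_self s₀)),
      pinW_dotProduct_udPt_of_mem s₀ (Finset.mem_singleton_self s₀)]
  · intro a _ j
    show (udRow a + pinW n s₀) ⬝ᵥ qPerm n lam (e j) ≤ (udRow a + pinW n s₀) ⬝ᵥ qPerm n lam (e jstar)
    rw [hj, pin_value, pin_value]
    exact neg_le_neg (mul_le_mul_of_nonneg_left (sum_rev_le hn s₀ hs a (e j)) hlam)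

/-- ★★★ **THE DIAGONAL PERMUTAHEDRON IS DECIDED** (xc currency, flat socket): for every `λ ≥ 0` and every listing `q` of
`Q^Π_λ`'s vertices containing `rev`, `HasEFOfSize (COR(n) + conv q) r ⟹ T c n < r`, eventually in `n`. -/
theorem qPerm_decided : ∀ c : ℕ, ∃ n₀ : ℕ, ∀ n ≥ n₀, ∀ (K : ℕ) (lam : ℝ) (e : Fin (K + 1) → Equiv.Perm (Fin n)) (r : ℕ),
    0 ≤ lam → (∃ j, e j = Fin.revPerm) →
    HasEFOfSize (corPolytope n + convexHull ℝ (Set.range (qPerm n lam ∘ e))) r → T c n < r := by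
  intro c
  obtain ⟨n₀, hn₀⟩ := pinExposed_decided c
  refine ⟨max n₀ 2, fun n hn K lam e r hlam hj hR => ?_⟩
  have h2 : 2 ≤ n := le_of_max_le_right hn
  obtain ⟨jstar, hj⟩ := hj
  exact hn₀ n (le_of_max_le_left hn) K _ r (pinExposed_qPerm h2 ⟨n - 1, by omega⟩ rfl hlam e jstar hj) hR

/-- ★★ Law currency: `pinnedRows.Law` (C⁺_loc, exact right-hand sides) HOLDS on `Q^Π_λ` with literal `T c n < r`. -/
theorem pinnedRows_law_holds_on_qPerm : ∀ c : ℕ, ∃ n₀ : ℕ, ∀ n ≥ n₀,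
    ∀ (K : ℕ) (lam : ℝ) (e : Fin (K + 1) → Equiv.Perm (Fin n)) (r : ℕ), 0 ≤ lam → (∃ j, e j = Fin.revPerm) →
    HasEFOfSize (convexHull ℝ (Set.range (qPerm n lam ∘ e))) r →
    ∀ mm : pinnedRows.A n → ℝ, (∀ a j, pinnedRows.ρ n a ⬝ᵥ (qPerm n lam ∘ e) j ≤ mm a) →
      (∀ a, ∃ j, pinnedRows.ρ n a ⬝ᵥ (qPerm n lam ∘ e) j = mm a) →
    ∀ (U : pinnedRows.A n → Option (Fin r) → ℝ) (V : Finset (Fin n) × Fin (K + 1) → Option (Fin r) → ℝ),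
      (∀ a i, 0 ≤ U a i) → (∀ p i, 0 ≤ V p i) →
      (∀ a b j, (pinnedRows.β n a + mm a) - pinnedRows.ρ n a ⬝ᵥ (udPt b + (qPerm n lam ∘ e) j) = ∑ i, U a i * V (b, j) i) →
      T c n < r := by
  intro c
  obtain ⟨n₀, hn₀⟩ := pinnedRows_law_on_pinExposed c
  refine ⟨max n₀ 2, fun n hn K lam e r hlam hj hq mm hle hat U V hU hV hfac => ?_⟩
  have h2 : 2 ≤ n := le_of_max_le_right hn
  obtain ⟨jstar, hj⟩ := hj
  exact hn₀ n (le_of_max_le_left hn) K _ r (pinExposed_qPerm h2 ⟨n - 1, by omega⟩ rfl hlam e jstar hj) hq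
    mm hle hat U V hU hV hfac

end PermClass

section ExactPerm
variable {n : ℕ}

/-- ★★★ **`ExactPencilLaw`'s body HOLDS ON THE DIAGONAL PERMUTAHEDRON `Q^Π_λ`** (the member that refuted C⁺_entry, N22):
the repaired statement of record MISSES the witness, in kernel. -/
theorem exactTilted_law_holds_on_qPerm : ∀ c : ℕ, ∃ n₀ : ℕ, ∀ n ≥ n₀,
    ∀ (K : ℕ) (lam : ℝ) (e : Fin (K + 1) → Equiv.Perm (Fin n)) (r : ℕ), 0 ≤ lam → (∃ j, e j = Fin.revPerm) →
    HasEFOfSize (convexHull ℝ (Set.range (qPerm n lam ∘ e))) r →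
    ∀ mm : exactTilted.A n → ℝ, (∀ a j, exactTilted.ρ n a ⬝ᵥ (qPerm n lam ∘ e) j ≤ mm a) →
      (∀ a, ∃ j, exactTilted.ρ n a ⬝ᵥ (qPerm n lam ∘ e) j = mm a) →
    ∀ (U : exactTilted.A n → Option (Fin r) → ℝ) (V : Finset (Fin n) × Fin (K + 1) → Option (Fin r) → ℝ),
      (∀ a i, 0 ≤ U a i) → (∀ p i, 0 ≤ V p i) →
      (∀ a b j, (exactTilted.β n a + mm a) - exactTilted.ρ n a ⬝ᵥ (udPt b + (qPerm n lam ∘ e) j)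
        = ∑ i, U a i * V (b, j) i) →
      T c n < r := by
  intro c
  obtain ⟨n₀, hn₀⟩ := pinnedRows_law_holds_on_qPerm c
  refine ⟨n₀, fun n hn K lam e r hlam hj hq => ?_⟩
  exact exact_body_of_pinned_body (qPerm n lam ∘ e) (hn₀ n hn K lam e r hlam hj hq)

end ExactPerm

end Summit.ValiantsHypothesis.ValiantsHypothesis.Theorems.FifoMatching.LocatedRows
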